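import Summits.BirchSwinnertonDyer.BirchSwinnertonDyer.Theorems.AlignedTransportAtTwoMainConjectureTransportAlignedAtTwoRhombicOfNegDisc
import Summits.BirchSwinnertonDyer.Rank1Residual.F1Sign2.BranchCongruenceModTwoAtTwoHolds
import Summits.BirchSwinnertonDyer.Rank1Residual.F1Sign2.RhombicBranchCongruenceHolds
import HarnessLib

/-!
# Route `AlignedTransportAtTwo`, crux C1 (stmt-BirchSwinnertonDyer-22296): COROLLARIES of `rhombicOfNegDisc_holds` for the cell's
# typed candidates — three cell statements that were «THEOREM modulo `RhombicOfNegDisc`» are now THEOREMS, and the two `Δ < 0`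
# readings IMC-A / IMC-K3 depend on the analytic `μ = 0` crux `AnalyticMuZeroAtTwo` ALONE

HONEST FRAMING (cell `bsd-f1-sign2`, WIDTH-5 attach seat `bsd-line-att-p4` g8; `--supports stmt-BirchSwinnertonDyer-22296 --as helper`).
THEOREMS ONLY (no `def`, no named fact, no `sorry`); every theorem is a one-line application of a landed reduction of the cell
(`BranchCongruenceModTwoAtTwoHolds`, `RhombicBranchCongruenceHolds`) to `…AlignedTransportAtTwoRhombicOfNegDisc.rhombicOfNegDisc_holds`
(p639434). BSD is NOT proved by any of this; no crux is closed; `AnalyticMuZeroAtTwo` (K2μ) stays OPEN and is displayed as a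
hypothesis where used. PARTITION: none moved by this file (the planner-of-record decides); what changes is the STATUS of three
CANDIDATES.md rows: IMC-A♮L curve-level ordinary (`OrdinaryBranchCongruenceAtTwo`), IMC-LAYER (`SupersingularLayerCongruenceAtTwo`) and the
repaired multiplicative reading (`MultBranchCongruenceAtTwoR`) no longer carry the support input `RhombicOfNegDisc`.

WHAT.
* `ordinaryBranchCongruenceAtTwo_holds : OrdinaryBranchCongruenceAtTwo` — `Δ < 0`, no rational `2`-torsion, good ordinary `2` ⇒
  `L₂(E, ω⁰) ≡ L₂⁻(E, ω¹) (mod 2Λ₂)` (curve-level A♮L), UNCONDITIONAL.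
* `supersingularLayerCongruenceAtTwo_holds : SupersingularLayerCongruenceAtTwo` — the finite-layer congruence on the supersingular block,
  UNCONDITIONAL.
* `multBranchCongruenceAtTwoR_holds : MultBranchCongruenceAtTwoR` — the repaired multiplicative-at-`2` reading, UNCONDITIONAL.
* `oddEvenCongruenceAtTwo_of_analyticMuZeroAtTwo : AnalyticMuZeroAtTwo → OddEvenCongruenceAtTwo` (IMC-A from K2μ alone),
  `oddBranchCertificateSupply_of_analyticMuZeroAtTwo : AnalyticMuZeroAtTwo → OddBranchCertificateSupply` (IMC-K3 from K2μ alone).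
  (The repaired multiplicative B, `oddEvenCongruenceMultAtTwoR_of_rhombicOfNegDisc_of_muZero`, likewise loses its `hR` input; it keeps the
  unregistered package-uniqueness hypothesis `hu`, so it is not restated here.)

References: [MazurTateTeitelbaum1986Invent] §I.8, §I.13; [CremonaAlgorithms1997] §2.10; [Greenberg1999] Conj. 1.11.
-/

set_option autoImplicit false
-- the route's Theorems namespace repeats a component by design (summit = sub-problem, D-0017).
set_option linter.dupNamespace false

noncomputable section

open scoped MatrixGroups ModularForm

open CongruenceSubgroup WeierstrassCurve
open Literature.NumberTheory.EllipticCurves Literature.NumberTheory.EllipticCurves.ModularForms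
  Literature.NumberTheory.EllipticCurves.Greenberg1999
  Summit.BirchSwinnertonDyer.Rank1Residual.F1Sign2
  Summit.BirchSwinnertonDyer.BirchSwinnertonDyer.Theorems.AlignedTransportAtTwoRhombicOfNegDisc

namespace Summit.BirchSwinnertonDyer.BirchSwinnertonDyer.Theorems.AlignedTransportAtTwoRhombicOfNegDiscCorollaries

/-- **IMC-A♮L, curve level, good ordinary `2` — now a THEOREM: `OrdinaryBranchCongruenceAtTwo` holds.** For `W/ℚ` globally minimal,
good ordinary at `2`, `Δ_W < 0`, no rational `2`-torsion abscissa, and its newform `f`: `BranchCongruenceModTwo f (unitRoot W 2)`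
(`L₂(E,ω⁰) ≡ L₂⁻(E,ω¹) (mod 2Λ₂)`). The cell's `ordinaryBranchCongruenceAtTwo_of_rhombicOfNegDisc` fed with `rhombicOfNegDisc_holds`.
[cite: MazurTateTeitelbaum1986Invent, §I.13 (p = 2 branches; the congruence is the cell's)] -/
theorem ordinaryBranchCongruenceAtTwo_holds : OrdinaryBranchCongruenceAtTwo :=
  ordinaryBranchCongruenceAtTwo_of_rhombicOfNegDisc rhombicOfNegDisc_holds

/-- **IMC-LAYER — now a THEOREM: `SupersingularLayerCongruenceAtTwo` holds** (`Δ < 0`, no rational `2`-torsion, good supersingular `2` ⇒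
`θ⁺_n − θ⁻_n − [1/2]⁺·ν_n ∈ ℤ[X]` for every `n`). The cell's `supersingularLayerCongruenceAtTwo_of_rhombicOfNegDisc` (A♮sym
`rhombicSymbolCongruence_holds` + glue) fed with `rhombicOfNegDisc_holds`. [cite: MazurTateTeitelbaum1986Invent, §I.13 (p = 2)] -/
theorem supersingularLayerCongruenceAtTwo_holds : SupersingularLayerCongruenceAtTwo :=
  supersingularLayerCongruenceAtTwo_of_rhombicOfNegDisc rhombicOfNegDisc_holds

/-- **Repaired multiplicative reading — now a THEOREM: `MultBranchCongruenceAtTwoR` holds** (`Δ < 0`, no rational `2`-torsion,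
multiplicative `2` ⇒ `BranchCongruenceModTwoMult f (a₂(E))`). The cell's `multBranchCongruenceAtTwoR_of_rhombicOfNegDisc` fed with
`rhombicOfNegDisc_holds`. [cite: MazurTateTeitelbaum1986Invent, §I.14 (multiplicative p; the congruence is the cell's)] -/
theorem multBranchCongruenceAtTwoR_holds : MultBranchCongruenceAtTwoR :=
  multBranchCongruenceAtTwoR_of_rhombicOfNegDisc rhombicOfNegDisc_holds

/-- **IMC-A from K2μ ALONE:** `AnalyticMuZeroAtTwo → OddEvenCongruenceAtTwo` (the lattice-shape input of
`oddEvenCongruenceAtTwo_of_rhombicOfNegDisc_of_muZero` is discharged). `AnalyticMuZeroAtTwo` is the OPEN crux, displayed as a hypothesis;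
nothing is asserted about it. [cite: Greenberg1999, Conj. 1.11 (posed for all p)] -/
theorem oddEvenCongruenceAtTwo_of_analyticMuZeroAtTwo (hμ : AnalyticMuZeroAtTwo) : OddEvenCongruenceAtTwo :=
  oddEvenCongruenceAtTwo_of_rhombicOfNegDisc_of_muZero rhombicOfNegDisc_holds hμ

/-- **IMC-K3 from K2μ ALONE:** `AnalyticMuZeroAtTwo → OddBranchCertificateSupply` (class-wide odd-branch certificate supply on the
`Δ < 0` habitat of the additive door). `AnalyticMuZeroAtTwo` displayed as a hypothesis. [cite: Greenberg1999, Conj. 1.11 (posed for all p)] -/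
theorem oddBranchCertificateSupply_of_analyticMuZeroAtTwo (hμ : AnalyticMuZeroAtTwo) : OddBranchCertificateSupply :=
  oddBranchCertificateSupply_of_rhombicOfNegDisc_of_muZero rhombicOfNegDisc_holds hμ

end Summit.BirchSwinnertonDyer.BirchSwinnertonDyer.Theorems.AlignedTransportAtTwoRhombicOfNegDiscCorollaries

end
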